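import Literature.NumberTheory.EllipticCurves.ImaginaryPeriod
import Literature.NumberTheory.EllipticCurves.GaussianLatticeQuarterValues
import Literature.NumberTheory.EllipticCurves.RealLatticeCovolumeProofs
import HarnessLib

/-!
# Néron-type periods of the quartic MODELS `y² = x³ + Ax`: `Ω⁺ = 2(Real.Gamma (1 / 4) ^ 2 / (2 * Real.sqrt (2 * Real.pi)))|A|^{−1/4}`, `|Ω⁻| = (Real.Gamma (1 / 4) ^ 2 / (2 * Real.sqrt (2 * Real.pi)))|A|^{−1/4}` (`A < 0`),
# `Ω⁺ = |Ω⁻| = √2·(Real.Gamma (1 / 4) ^ 2 / (2 * Real.sqrt (2 * Real.pi)))·A^{−1/4}` (`A > 0`) — STUB-PLAN piece P2 in model form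

Summit `BirchSwinnertonDyer`, crux `InertBadAtThree` (stmt-BirchSwinnertonDyer-19225), line of record `Lines/rubin_e1_inert_three.lean`
v5 (lead `bsd-line-ibd-p1` g6), registered stub `stub_plainOddNeronIntegralThreeQuartic` (v4: `stub_neronIntegralThreeQuartic`); STUB-PLAN
`Cruxes/InertBadAtThree/STUB-PLAN-neronIntegralThreeQuartic-bsd-idea-18-g8.md` piece **P2 `stub_quarticPeriods`**, here in MODEL form
(width seat bsd-wall-cm-bed-w3 g8, `--supports 19225`, helper). By `…InertBadAtThreeQuarticModel.LValueOdd_of_quarticModel` (p628739) the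
`f`-free target of the value exit (p627747) may be proved on a quartic MODEL `⟨0, 0, 0, A, 0⟩ = (y² = x³ + Ax)` of `V` with the model's OWN
periods; this file computes those periods EXACTLY (no power of `2`, no minimalisation at `2`):

* `minRealPeriod_mulLeft_one_add_I` — the least positive real period of `(1 + i)(ℤi + ℤ)` is `2`;
  `lattice_mulLeft_mulLeft_I_eq` — `c·Λ` is `i`-stable whenever `Λ` is (`ℤi + ℤ` is: `GaussianLattice.mulLeft_I_lattice_eq`).
* Over `ℝ`, for `a ≠ 0` and `E_a = ⟨0, 0, 0, a, 0⟩` (`c₄ = −48a`, `c₆ = 0`, `Δ = −64a³`): the period lattice is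
  `(Real.Gamma (1 / 4) ^ 2 / (2 * Real.sqrt (2 * Real.pi)))|a|^{−1/4}·(ℤi + ℤ)` for `a < 0` (`g₂ = 4|a| = c₄/12`) and `((Real.Gamma (1 / 4) ^ 2 / (2 * Real.sqrt (2 * Real.pi)))|a|^{−1/4}/√2)·(1 + i)(ℤi + ℤ)` for `a > 0` (`(1+i)⁴ = −4`, `g₂ = −4a`),
  whence (`realPeriod_eq_numRealComponents_mul_minRealPeriod`, `imaginaryPeriod_eq`, `minRealPeriod_mulLeft_ofReal`,
  `GaussianLattice.minRealPeriod_eq = 1`, `g₂_eq_varpi'`):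
  `realPeriod_quartic_of_neg` (`= 2·(Real.Gamma (1 / 4) ^ 2 / (2 * Real.sqrt (2 * Real.pi)))|a|^{−1/4}`), `imaginaryPeriod_quartic_of_neg` (`= (Real.Gamma (1 / 4) ^ 2 / (2 * Real.sqrt (2 * Real.pi)))|a|^{−1/4}`),
  `realPeriod_quartic_of_pos`, `imaginaryPeriod_quartic_of_pos` (both `= √2·(Real.Gamma (1 / 4) ^ 2 / (2 * Real.sqrt (2 * Real.pi)))·a^{−1/4}`).
* Over `ℚ` (`realPeriodRat`, `imaginaryPeriodRat` = the above for the base change), for `A ∈ ℤ ∖ 0`: `realPeriodRat_quartic_of_neg/pos`,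
  `imaginaryPeriodRat_quartic_of_neg/pos`, and the plan-shaped corollary `quarticModelPeriods` (`∃ a ∈ ℤ, ε ≤ 1`, …`2^a (√2)^ε (Real.Gamma (1 / 4) ^ 2 / (2 * Real.sqrt (2 * Real.pi))) |A|^{−1/4}`).
Here `(Real.Gamma (1 / 4) ^ 2 / (2 * Real.sqrt (2 * Real.pi))) = Γ(1/4)²/(2√(2π))` (`= tunnellPeriod`, the real half-period of `y² = x³ − x`). Consequence for P6: `v₃(Ω^±(E_A)⁻¹·(Real.Gamma (1 / 4) ^ 2 / (2 * Real.sqrt (2 * Real.pi)))) = +v₃(A)/4`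
exactly, the factors `2`, `√2` being `3`-adic units.

HONEST FRAMING: nothing here proves the stub, the crux or BSD. No definition, no named fact, no `sorry`; axioms standard.
-/

set_option autoImplicit false
set_option linter.dupNamespace false

noncomputable section

open Complex PeriodPair WeierstrassCurve
open Literature.NumberTheory.EllipticCurves

namespace Summit.BirchSwinnertonDyer.BirchSwinnertonDyer.Theorems.InertBadSignedBranchesInertBadAtThreeQuarticModelPeriods

-- No notation is introduced (typer lint): the Gaussian pair `Λᵢ` of `GaussianLatticeQuarterValues` is written `PeriodPair.ofUpperHalfPlane UpperHalfPlane.I`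
-- and the lemniscatic constant `(Real.Gamma (1 / 4) ^ 2 / (2 * Real.sqrt (2 * Real.pi)))` is written out as `Real.Gamma (1 / 4) ^ 2 / (2 * Real.sqrt (2 * Real.pi))`.

/-! ## §1 Two lattice lemmas -/

section Lattice

/-- **The least positive real period of `(1 + i)(ℤi + ℤ) = {m + ni : m ≡ n (2)}` is `2`.** [folklore] -/
theorem minRealPeriod_mulLeft_one_add_I (h1 : (1 + I : ℂ) ≠ 0) :
    ((PeriodPair.ofUpperHalfPlane UpperHalfPlane.I).mulLeft (1 + I) h1).minRealPeriod = 2 := by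
  have hmul : (1 + I : ℂ) * ((1 - I) / 2) = 1 := by
    ring_nf; rw [Complex.I_sq]; ring
  have hinv : (1 + I : ℂ)⁻¹ = (1 - I) / 2 := (eq_inv_of_mul_eq_one_right hmul).symm
  have h2 : (2 : ℝ) ∈ ((PeriodPair.ofUpperHalfPlane UpperHalfPlane.I).mulLeft (1 + I) h1).realPeriods := by
    refine ⟨two_pos, ?_⟩
    rw [mem_mulLeft_lattice, GaussianLattice.mem_lattice_iff]
    refine ⟨-1, 1, ?_⟩
    rw [hinv]; push_cast; ring
  have hleast : IsLeast ((PeriodPair.ofUpperHalfPlane UpperHalfPlane.I).mulLeft (1 + I) h1).realPeriods 2 := by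
    refine ⟨h2, fun t ht ↦ ?_⟩
    obtain ⟨ht0, htmem⟩ := ht
    rw [mem_mulLeft_lattice, GaussianLattice.mem_lattice_iff, hinv] at htmem
    obtain ⟨m, n, h⟩ := htmem
    have hre := congrArg Complex.re h
    simp only [Complex.add_re, Complex.mul_re, Complex.intCast_re, Complex.I_re, mul_zero, Complex.intCast_im,
      Complex.I_im, mul_one, sub_self, zero_add, Complex.div_re, Complex.sub_re, Complex.one_re,
      Complex.ofReal_re, Complex.sub_im, Complex.one_im, Complex.ofReal_im, Complex.normSq_ofNat,
      Complex.re_ofNat, Complex.im_ofNat] at hre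
    -- `hre : n = t/2`-type relation
    have hn : (n : ℝ) * 2 = t := by nlinarith [hre]
    have hn1 : (1 : ℤ) ≤ n := by
      have : (0 : ℝ) < n := by nlinarith
      exact_mod_cast this
    have : (1 : ℝ) ≤ n := by exact_mod_cast hn1
    linarith
  rw [PeriodPair.minRealPeriod]
  exact hleast.csInf_eq

/-- **`i`-stability is inherited by homothetic lattices**: if `iΛ = Λ` then `i(cΛ) = cΛ` (as lattices). [folklore] -/
theorem lattice_mulLeft_mulLeft_I_eq {L : PeriodPair} (hL : (L.mulLeft I I_ne_zero).lattice = L.lattice)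
    (c : ℂ) (hc : c ≠ 0) : ((L.mulLeft c hc).mulLeft I I_ne_zero).lattice = (L.mulLeft c hc).lattice := by
  rw [lattice_mulLeft_mulLeft L hc I_ne_zero]
  have h : (L.mulLeft (I * c) (mul_ne_zero I_ne_zero hc)).lattice =
      ((L.mulLeft I I_ne_zero).mulLeft c hc).lattice := by
    rw [lattice_mulLeft_mulLeft L I_ne_zero hc]
    congr 2
    ring
  rw [h, mulLeft_lattice_eq_of_lattice_eq hc hL]

/-- `(1 + i)(ℤi + ℤ)` is `i`-stable. [folklore] -/
theorem lattice_mulLeft_one_add_I_mulLeft_I (h1 : (1 + I : ℂ) ≠ 0) :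
    (((PeriodPair.ofUpperHalfPlane UpperHalfPlane.I).mulLeft (1 + I) h1).mulLeft I I_ne_zero).lattice =
      ((PeriodPair.ofUpperHalfPlane UpperHalfPlane.I).mulLeft (1 + I) h1).lattice :=
  lattice_mulLeft_mulLeft_I_eq GaussianLattice.mulLeft_I_lattice_eq _ _

end Lattice

/-! ## §2 The quartic models over `ℝ` -/

section Real

variable (a : ℝ)

/-- `c₄(y² = x³ + ax) = −48a`. [cite: SilvermanAEC2009, III.1] -/
theorem quartic_c₄ : (⟨0, 0, 0, a, 0⟩ : WeierstrassCurve ℝ).c₄ = -48 * a := by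
  simp only [WeierstrassCurve.c₄, WeierstrassCurve.b₂, WeierstrassCurve.b₄]; ring

/-- `c₆(y² = x³ + ax) = 0`. [cite: SilvermanAEC2009, III.1] -/
theorem quartic_c₆ : (⟨0, 0, 0, a, 0⟩ : WeierstrassCurve ℝ).c₆ = 0 := by
  simp only [WeierstrassCurve.c₆, WeierstrassCurve.b₂, WeierstrassCurve.b₄, WeierstrassCurve.b₆]; ring

/-- `Δ(y² = x³ + ax) = −64a³`. [cite: SilvermanAEC2009, III.1] -/
theorem quartic_Δ : (⟨0, 0, 0, a, 0⟩ : WeierstrassCurve ℝ).Δ = -64 * a ^ 3 := by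
  simp only [WeierstrassCurve.Δ, WeierstrassCurve.b₂, WeierstrassCurve.b₄, WeierstrassCurve.b₆, WeierstrassCurve.b₈]
  ring

/-- `y² = x³ + ax` is elliptic for `a ≠ 0`. [cite: SilvermanAEC2009, III.1] -/
theorem quartic_isElliptic (ha : a ≠ 0) : (⟨0, 0, 0, a, 0⟩ : WeierstrassCurve ℝ).IsElliptic :=
  ⟨by rw [isUnit_iff_ne_zero, quartic_Δ]; exact mul_ne_zero (by norm_num) (pow_ne_zero 3 ha)⟩

/-- The scaling factor `(Real.Gamma (1 / 4) ^ 2 / (2 * Real.sqrt (2 * Real.pi)))·|a|^{−1/4}` is positive. [folklore] -/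
theorem varpi_mul_rpow_pos (ha : a ≠ 0) : 0 < (Real.Gamma (1 / 4) ^ 2 / (2 * Real.sqrt (2 * Real.pi))) * |a| ^ (-(1 / 4 : ℝ)) :=
  mul_pos (by positivity) (Real.rpow_pos_of_pos (abs_pos.mpr ha) _)

/-- `(|a|^{−1/4})⁴ = |a|⁻¹`. [folklore] -/
theorem rpow_neg_quarter_pow_four : (|a| ^ (-(1 / 4 : ℝ))) ^ 4 = |a|⁻¹ := by
  rw [← Real.rpow_natCast, ← Real.rpow_mul (abs_nonneg a)]
  norm_num
  exact Real.rpow_neg_one |a|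

/-- The period lattice of `y² = x³ + ax`, `a < 0`: `(Real.Gamma (1 / 4) ^ 2 / (2 * Real.sqrt (2 * Real.pi)))|a|^{−1/4}·(ℤi + ℤ)` has `g₂ = 4|a| = −4a = c₄/12`.
[cite: SilvermanAEC2009, VI.3 and proof of Cor. VI.5.1.1] -/
theorem g₂_lattice_of_neg (ha : a < 0) :
    ((PeriodPair.ofUpperHalfPlane UpperHalfPlane.I).mulLeft (((Real.Gamma (1 / 4) ^ 2 / (2 * Real.sqrt (2 * Real.pi))) * |a| ^ (-(1 / 4 : ℝ)) : ℝ) : ℂ)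
        (by exact_mod_cast (varpi_mul_rpow_pos a ha.ne).ne')).g₂ =
      (((⟨0, 0, 0, a, 0⟩ : WeierstrassCurve ℝ).c₄ / 12 : ℝ) : ℂ) := by
  rw [g₂_mulLeft, GaussianLattice.g₂_eq_varpi', quartic_c₄]
  have hϖ : ((Real.Gamma (1 / 4) ^ 2 / (2 * Real.sqrt (2 * Real.pi))) : ℝ) ≠ 0 := by positivity
  have hr : (|a| ^ (-(1 / 4 : ℝ)) : ℝ) ≠ 0 := (Real.rpow_pos_of_pos (abs_pos.mpr ha.ne) _).ne'
  have h4 := rpow_neg_quarter_pow_four a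
  have habs : |a| = -a := abs_of_neg ha
  have key : (((Real.Gamma (1 / 4) ^ 2 / (2 * Real.sqrt (2 * Real.pi))) * |a| ^ (-(1 / 4 : ℝ)) : ℝ) ^ 4)⁻¹ * (4 * (Real.Gamma (1 / 4) ^ 2 / (2 * Real.sqrt (2 * Real.pi))) ^ 4) = (-48 * a / 12 : ℝ) := by
    rw [mul_pow, h4, habs]
    field_simp
    ring
  have := congrArg (fun x : ℝ ↦ (x : ℂ)) key
  push_cast at this ⊢
  exact this

/-- `(1 + i)⁴ = −4`. [folklore] -/
theorem one_add_I_pow_four : (1 + I : ℂ) ^ 4 = -4 := by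
  have : (1 + I : ℂ) ^ 2 = 2 * I := by ring_nf; rw [Complex.I_sq]; ring
  rw [show (4 : ℕ) = 2 * 2 from rfl, pow_mul, this, mul_pow, Complex.I_sq]; ring

/-- The period lattice of `y² = x³ + ax`, `a > 0`: `((Real.Gamma (1 / 4) ^ 2 / (2 * Real.sqrt (2 * Real.pi)))a^{−1/4}/√2)·(1 + i)(ℤi + ℤ)` has `g₂ = −4a = c₄/12` (`(1+i)⁴ = −4`).
[cite: SilvermanAEC2009, VI.3 and proof of Cor. VI.5.1.1] -/
theorem g₂_lattice_of_pos (ha : 0 < a) (h1 : (1 + I : ℂ) ≠ 0) :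
    (((PeriodPair.ofUpperHalfPlane UpperHalfPlane.I).mulLeft (1 + I) h1).mulLeft (((Real.Gamma (1 / 4) ^ 2 / (2 * Real.sqrt (2 * Real.pi))) * |a| ^ (-(1 / 4 : ℝ)) / Real.sqrt 2 : ℝ) : ℂ)
        (by exact_mod_cast (div_pos (varpi_mul_rpow_pos a ha.ne') (Real.sqrt_pos.mpr two_pos)).ne')).g₂ =
      (((⟨0, 0, 0, a, 0⟩ : WeierstrassCurve ℝ).c₄ / 12 : ℝ) : ℂ) := by
  rw [g₂_mulLeft, g₂_mulLeft, GaussianLattice.g₂_eq_varpi', quartic_c₄, one_add_I_pow_four]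
  have hϖ : ((Real.Gamma (1 / 4) ^ 2 / (2 * Real.sqrt (2 * Real.pi))) : ℝ) ≠ 0 := by positivity
  have hr : (|a| ^ (-(1 / 4 : ℝ)) : ℝ) ≠ 0 := (Real.rpow_pos_of_pos (abs_pos.mpr ha.ne') _).ne'
  have h4 := rpow_neg_quarter_pow_four a
  have habs : |a| = a := abs_of_pos ha
  have hs4 : (Real.sqrt 2 : ℝ) ^ 4 = 4 := by
    rw [show (4 : ℕ) = 2 * 2 from rfl, pow_mul, Real.sq_sqrt (by norm_num)]; norm_num
  have hs0 : (Real.sqrt 2 : ℝ) ≠ 0 := (Real.sqrt_pos.mpr two_pos).ne'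
  have key : (((Real.Gamma (1 / 4) ^ 2 / (2 * Real.sqrt (2 * Real.pi))) * |a| ^ (-(1 / 4 : ℝ)) / Real.sqrt 2 : ℝ) ^ 4)⁻¹ * ((-4 : ℝ)⁻¹ * (4 * (Real.Gamma (1 / 4) ^ 2 / (2 * Real.sqrt (2 * Real.pi))) ^ 4)) =
      (-48 * a / 12 : ℝ) := by
    rw [div_pow, mul_pow, h4, habs, hs4]
    field_simp
    ring
  have := congrArg (fun x : ℝ ↦ (x : ℂ)) key
  push_cast at this ⊢
  exact this

/-- ★ **`Ω⁺(y² = x³ + ax) = 2(Real.Gamma (1 / 4) ^ 2 / (2 * Real.sqrt (2 * Real.pi)))|a|^{−1/4}` for `a < 0`** (two real components, rectangular lattice `(Real.Gamma (1 / 4) ^ 2 / (2 * Real.sqrt (2 * Real.pi)))|a|^{−1/4}(ℤi + ℤ)`).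
[cite: SilvermanAEC2009, Thm VI.5.1 and C.16] [cite: CremonaAlgorithms1997, §3.7] -/
theorem realPeriod_quartic_of_neg (ha : a < 0) :
    (⟨0, 0, 0, a, 0⟩ : WeierstrassCurve ℝ).realPeriod = 2 * ((Real.Gamma (1 / 4) ^ 2 / (2 * Real.sqrt (2 * Real.pi))) * |a| ^ (-(1 / 4 : ℝ))) := by
  haveI := quartic_isElliptic a ha.ne
  have hc := varpi_mul_rpow_pos a ha.ne
  rw [realPeriod_eq_numRealComponents_mul_minRealPeriod (⟨0, 0, 0, a, 0⟩ : WeierstrassCurve ℝ)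
      (g₂_lattice_of_neg a ha) (by rw [g₃_mulLeft, g₃_ofUpperHalfPlane_I, quartic_c₆]; simp),
    minRealPeriod_mulLeft_ofReal _ hc, GaussianLattice.minRealPeriod_eq, mul_one,
    numRealComponents_of_Δ_pos _ (by rw [quartic_Δ]; linarith [Odd.pow_neg (by decide : Odd 3) ha])]
  push_cast; ring

/-- ★ **`|Ω⁻(y² = x³ + ax)| = (Real.Gamma (1 / 4) ^ 2 / (2 * Real.sqrt (2 * Real.pi)))|a|^{−1/4}` for `a < 0`** (the lattice is `i`-stable). [cite: Pal2012, p. 1514] [cite: SilvermanAEC2009, Thm VI.5.1] -/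
theorem imaginaryPeriod_quartic_of_neg (ha : a < 0) :
    (⟨0, 0, 0, a, 0⟩ : WeierstrassCurve ℝ).imaginaryPeriod = (Real.Gamma (1 / 4) ^ 2 / (2 * Real.sqrt (2 * Real.pi))) * |a| ^ (-(1 / 4 : ℝ)) := by
  haveI := quartic_isElliptic a ha.ne
  have hc := varpi_mul_rpow_pos a ha.ne
  rw [imaginaryPeriod_eq (⟨0, 0, 0, a, 0⟩ : WeierstrassCurve ℝ)
      (g₂_lattice_of_neg a ha) (by rw [g₃_mulLeft, g₃_ofUpperHalfPlane_I, quartic_c₆]; simp),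
    minRealPeriod_eq_of_lattice_eq (lattice_mulLeft_mulLeft_I_eq GaussianLattice.mulLeft_I_lattice_eq _ _),
    minRealPeriod_mulLeft_ofReal _ hc, GaussianLattice.minRealPeriod_eq, mul_one]

/-- ★ **`Ω⁺(y² = x³ + ax) = √2·(Real.Gamma (1 / 4) ^ 2 / (2 * Real.sqrt (2 * Real.pi)))·a^{−1/4}` for `a > 0`** (one real component, lattice `((Real.Gamma (1 / 4) ^ 2 / (2 * Real.sqrt (2 * Real.pi)))a^{−1/4}/√2)(1 + i)(ℤi + ℤ)`).
[cite: SilvermanAEC2009, Thm VI.5.1 and C.16] [cite: CremonaAlgorithms1997, §3.7] -/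
theorem realPeriod_quartic_of_pos (ha : 0 < a) :
    (⟨0, 0, 0, a, 0⟩ : WeierstrassCurve ℝ).realPeriod = Real.sqrt 2 * ((Real.Gamma (1 / 4) ^ 2 / (2 * Real.sqrt (2 * Real.pi))) * |a| ^ (-(1 / 4 : ℝ))) := by
  haveI := quartic_isElliptic a ha.ne'
  have hc : 0 < (Real.Gamma (1 / 4) ^ 2 / (2 * Real.sqrt (2 * Real.pi))) * |a| ^ (-(1 / 4 : ℝ)) / Real.sqrt 2 :=
    div_pos (varpi_mul_rpow_pos a ha.ne') (Real.sqrt_pos.mpr two_pos)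
  have h1 : (1 + I : ℂ) ≠ 0 := by intro h; simpa using congrArg Complex.re h
  rw [realPeriod_eq_numRealComponents_mul_minRealPeriod (⟨0, 0, 0, a, 0⟩ : WeierstrassCurve ℝ)
      (g₂_lattice_of_pos a ha h1) (by rw [g₃_mulLeft, g₃_mulLeft, g₃_ofUpperHalfPlane_I, quartic_c₆]; simp),
    minRealPeriod_mulLeft_ofReal _ hc, minRealPeriod_mulLeft_one_add_I h1,
    numRealComponents_of_Δ_nonpos _ (by rw [quartic_Δ]; nlinarith [ha, sq_nonneg a, pow_pos ha 3])]
  have hs0 : (Real.sqrt 2 : ℝ) ≠ 0 := (Real.sqrt_pos.mpr two_pos).ne'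
  have hs2 : (Real.sqrt 2 : ℝ) ^ 2 = 2 := Real.sq_sqrt (by norm_num)
  push_cast
  field_simp
  nlinarith [hs2]

/-- ★ **`|Ω⁻(y² = x³ + ax)| = √2·(Real.Gamma (1 / 4) ^ 2 / (2 * Real.sqrt (2 * Real.pi)))·a^{−1/4}` for `a > 0`** (the lattice is `i`-stable). [cite: Pal2012, p. 1514] [cite: SilvermanAEC2009, Thm VI.5.1] -/
theorem imaginaryPeriod_quartic_of_pos (ha : 0 < a) :
    (⟨0, 0, 0, a, 0⟩ : WeierstrassCurve ℝ).imaginaryPeriod = Real.sqrt 2 * ((Real.Gamma (1 / 4) ^ 2 / (2 * Real.sqrt (2 * Real.pi))) * |a| ^ (-(1 / 4 : ℝ))) := by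
  haveI := quartic_isElliptic a ha.ne'
  have hc : 0 < (Real.Gamma (1 / 4) ^ 2 / (2 * Real.sqrt (2 * Real.pi))) * |a| ^ (-(1 / 4 : ℝ)) / Real.sqrt 2 :=
    div_pos (varpi_mul_rpow_pos a ha.ne') (Real.sqrt_pos.mpr two_pos)
  have h1 : (1 + I : ℂ) ≠ 0 := by intro h; simpa using congrArg Complex.re h
  rw [imaginaryPeriod_eq (⟨0, 0, 0, a, 0⟩ : WeierstrassCurve ℝ)
      (g₂_lattice_of_pos a ha h1) (by rw [g₃_mulLeft, g₃_mulLeft, g₃_ofUpperHalfPlane_I, quartic_c₆]; simp),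
    minRealPeriod_eq_of_lattice_eq (lattice_mulLeft_mulLeft_I_eq (lattice_mulLeft_one_add_I_mulLeft_I h1) _ _),
    minRealPeriod_mulLeft_ofReal _ hc, minRealPeriod_mulLeft_one_add_I h1]
  have hs0 : (Real.sqrt 2 : ℝ) ≠ 0 := (Real.sqrt_pos.mpr two_pos).ne'
  have hs2 : (Real.sqrt 2 : ℝ) ^ 2 = 2 := Real.sq_sqrt (by norm_num)
  field_simp
  nlinarith [hs2]

end Real

/-! ## §3 The quartic models over `ℚ` -/

section Rat

variable (A : ℤ)

/-- The base change to `ℝ` of `⟨0, 0, 0, A, 0⟩/ℚ` is `⟨0, 0, 0, A, 0⟩/ℝ`. [folklore] -/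
theorem baseChange_quartic :
    ((⟨0, 0, 0, (A : ℚ), 0⟩ : WeierstrassCurve ℚ).baseChange ℝ) = (⟨0, 0, 0, (A : ℝ), 0⟩ : WeierstrassCurve ℝ) := by
  ext <;> simp [WeierstrassCurve.baseChange, WeierstrassCurve.map]

/-- ★ `Ω⁺(⟨0,0,0,A,0⟩/ℚ) = 2(Real.Gamma (1 / 4) ^ 2 / (2 * Real.sqrt (2 * Real.pi)))|A|^{−1/4}` for `A < 0`. [cite: SilvermanAEC2009, Thm VI.5.1 and C.16] -/
theorem realPeriodRat_quartic_of_neg (hA : A < 0) :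
    (⟨0, 0, 0, (A : ℚ), 0⟩ : WeierstrassCurve ℚ).realPeriodRat = 2 * ((Real.Gamma (1 / 4) ^ 2 / (2 * Real.sqrt (2 * Real.pi))) * |(A : ℝ)| ^ (-(1 / 4 : ℝ))) := by
  rw [realPeriodRat_def, baseChange_quartic, realPeriod_quartic_of_neg _ (by exact_mod_cast hA)]

/-- ★ `|Ω⁻(⟨0,0,0,A,0⟩/ℚ)| = (Real.Gamma (1 / 4) ^ 2 / (2 * Real.sqrt (2 * Real.pi)))|A|^{−1/4}` for `A < 0`. [cite: Pal2012, p. 1514] -/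
theorem imaginaryPeriodRat_quartic_of_neg (hA : A < 0) :
    (⟨0, 0, 0, (A : ℚ), 0⟩ : WeierstrassCurve ℚ).imaginaryPeriodRat = (Real.Gamma (1 / 4) ^ 2 / (2 * Real.sqrt (2 * Real.pi))) * |(A : ℝ)| ^ (-(1 / 4 : ℝ)) := by
  rw [imaginaryPeriodRat_def, baseChange_quartic, imaginaryPeriod_quartic_of_neg _ (by exact_mod_cast hA)]

/-- ★ `Ω⁺(⟨0,0,0,A,0⟩/ℚ) = √2·(Real.Gamma (1 / 4) ^ 2 / (2 * Real.sqrt (2 * Real.pi)))·A^{−1/4}` for `A > 0`. [cite: SilvermanAEC2009, Thm VI.5.1 and C.16] -/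
theorem realPeriodRat_quartic_of_pos (hA : 0 < A) :
    (⟨0, 0, 0, (A : ℚ), 0⟩ : WeierstrassCurve ℚ).realPeriodRat = Real.sqrt 2 * ((Real.Gamma (1 / 4) ^ 2 / (2 * Real.sqrt (2 * Real.pi))) * |(A : ℝ)| ^ (-(1 / 4 : ℝ))) := by
  rw [realPeriodRat_def, baseChange_quartic, realPeriod_quartic_of_pos _ (by exact_mod_cast hA)]

/-- ★ `|Ω⁻(⟨0,0,0,A,0⟩/ℚ)| = √2·(Real.Gamma (1 / 4) ^ 2 / (2 * Real.sqrt (2 * Real.pi)))·A^{−1/4}` for `A > 0`. [cite: Pal2012, p. 1514] -/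
theorem imaginaryPeriodRat_quartic_of_pos (hA : 0 < A) :
    (⟨0, 0, 0, (A : ℚ), 0⟩ : WeierstrassCurve ℚ).imaginaryPeriodRat = Real.sqrt 2 * ((Real.Gamma (1 / 4) ^ 2 / (2 * Real.sqrt (2 * Real.pi))) * |(A : ℝ)| ^ (-(1 / 4 : ℝ))) := by
  rw [imaginaryPeriodRat_def, baseChange_quartic, imaginaryPeriod_quartic_of_pos _ (by exact_mod_cast hA)]

/-- ★ **STUB-PLAN P2 in model form** (`stub_quarticPeriods` shape, for the model itself): for `A ≠ 0`,
`Ω⁺(⟨0,0,0,A,0⟩) = 2^a(√2)^ε·(Real.Gamma (1 / 4) ^ 2 / (2 * Real.sqrt (2 * Real.pi)))·|A|^{−1/4}` and `|Ω⁻(⟨0,0,0,A,0⟩)| = 2^{a'}(√2)^{ε'}·(Real.Gamma (1 / 4) ^ 2 / (2 * Real.sqrt (2 * Real.pi)))·|A|^{−1/4}` with `a, a' ∈ ℤ`, `ε, ε' ≤ 1`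
(in fact `(a, ε; a', ε') = (1, 0; 0, 0)` for `A < 0` and `(0, 1; 0, 1)` for `A > 0`). [cite: SilvermanAEC2009, Thm VI.5.1 and C.16] [cite: Pal2012, p. 1514] -/
theorem quarticModelPeriods (hA : A ≠ 0) :
    (∃ (a : ℤ) (ε : ℕ), ε ≤ 1 ∧
        (⟨0, 0, 0, (A : ℚ), 0⟩ : WeierstrassCurve ℚ).realPeriodRat =
          2 ^ a * Real.sqrt 2 ^ ε * (Real.Gamma (1 / 4) ^ 2 / (2 * Real.sqrt (2 * Real.pi))) * |(A : ℝ)| ^ (-(1 / 4 : ℝ))) ∧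
      (∃ (a : ℤ) (ε : ℕ), ε ≤ 1 ∧
        (⟨0, 0, 0, (A : ℚ), 0⟩ : WeierstrassCurve ℚ).imaginaryPeriodRat =
          2 ^ a * Real.sqrt 2 ^ ε * (Real.Gamma (1 / 4) ^ 2 / (2 * Real.sqrt (2 * Real.pi))) * |(A : ℝ)| ^ (-(1 / 4 : ℝ))) := by
  rcases lt_or_gt_of_ne hA with h | h
  · exact ⟨⟨1, 0, zero_le_one, by rw [realPeriodRat_quartic_of_neg A h]; ring⟩,
      ⟨0, 0, zero_le_one, by rw [imaginaryPeriodRat_quartic_of_neg A h]; ring⟩⟩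
  · exact ⟨⟨0, 1, le_rfl, by rw [realPeriodRat_quartic_of_pos A h]; ring⟩,
      ⟨0, 1, le_rfl, by rw [imaginaryPeriodRat_quartic_of_pos A h]; ring⟩⟩

end Rat

end Summit.BirchSwinnertonDyer.BirchSwinnertonDyer.Theorems.InertBadSignedBranchesInertBadAtThreeQuarticModelPeriods

end
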